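import Summits.BirchSwinnertonDyer.BirchSwinnertonDyer.Theorems.ThetaPartnerAtTwoSignedTransportAtTwoResidualLowerTools
import Literature.NumberTheory.DiophantineGeometry.LocalReductionFiniteBadPlacesProofs
import HarnessLib

/-!
# Stub `stub_sel2L0` of line `bridge` v11 of the crux `SignedTransportAtTwo` (stmt-BirchSwinnertonDyer-20333, route
# `ThetaPartnerAtTwo`) — PROVED: the LOWER containment of the residual devissage at `2` on the CM side
# (lead prover bsd-wall-tp2-p1 g4; `--supports stmt-BirchSwinnertonDyer-20333`, registered stub by name + signature)

HONEST FRAMING. THEOREM ONLY; it proves one of the five registered stubs of the skeleton of record (v11, sha16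
3df8de797086265a) and nothing else; the crux stays open (stubs `stub_sel2T`, `stub_sel2F`, `stub_lam2d`, `stub_V2mtR`);
BSD is not proved by any of this. No import of any route file.

WHAT. For a residual class `c ∈ H¹(ℚ_∞, A[2^∞][2])` (cyclotomic `κ`) that is unramified at EVERY odd place, residually
trivial at `∞`, and whose Kummer image `k(c)` satisfies
the signed Kummer condition above `2` over `ℚ_∞` w.r.t. `⨆ₙ A⁺(ℚ_{n,2})`: `k(c) ∈ Sel⁺(A/ℚ_∞) = ⋃ₙ res Sel⁺(A/ℚ_n)`.
Proof = the potss cell's `fineSelmerInfty_le_signedSelmerInfty` with the torsion witnesses at `p` replaced by the DESCENDED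
signed witnesses (`exists_forall_conjH1_resOfLe_mem_localKummerOverOfEmb`, file `…ResidualLowerTools`).

References: [GreenbergVatsal2000] p. 3, Prop. (2.8); [BDKim2009] Prop. 2.10; [Kobayashi2003] Def. 1.1;
[GreenbergLNM1716] §3 Lemmas 3.2–3.3.
-/

set_option autoImplicit false
-- D-0017: single-problem summit, so `Summit.BirchSwinnertonDyer.BirchSwinnertonDyer.…` repeats a namespace BY DESIGN.
set_option linter.dupNamespace false

noncomputable section

open scoped Classical AddSubgroup

open WeierstrassCurve NumberField IsDedekindDomain Field Literature Literature.NumberTheory.EllipticCurves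
  Literature.NumberTheory.GaloisRepresentations Literature.NumberTheory.EllipticCurves.Kobayashi2003 ZpExtension
  Literature.NumberTheory.EllipticCurves.GreenbergVatsal2000 Literature.NumberTheory.EllipticCurves.GreenbergSelmer
  Literature.NumberTheory.EllipticCurves.Rank1Residual
  Summit.BirchSwinnertonDyer.Rank1Residual.Additive
  Summit.BirchSwinnertonDyer.Rank1Residual.X2.GreenbergVatsalUnramifiedAway
  Summit.BirchSwinnertonDyer.BirchSwinnertonDyer.Theorems.FineSelmerLeSignedSelmer

namespace Summit.BirchSwinnertonDyer.BirchSwinnertonDyer.Theorems.SignedTransportAtTwo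

universe u

/-! ## Step 1′: the classical Selmer conditions over `ℚ_∞` for classes unramified at every odd place -/

section StepOne

variable (W : WeierstrassCurve ℚ) [W.IsElliptic] (κ : ZpExtension ℚ 2)

/-- **The classical Selmer conditions over `ℚ_∞` from the residual conditions, unramified form.** For a residual class
`c ∈ H¹(ℚ_∞, E[2^∞][2])` (cyclotomic `κ`) unramified at EVERY odd place (⇒ the classical condition there, ANY reduction
type: Additive cell's `unramKer_le_localKerOver_of_isCyclotomic`, GV p. 17), residually trivial at `∞`
(`infKer_le_localKerOver`) and signed-Kummer at the places above `2` (`localKummerOverOfEmb_le_localKerOverOfEmb`):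
`k(c) ∈ Sel_{2^∞}(E/ℚ_∞)`. [cite: GreenbergVatsal2000, §2 p. 17] [cite: GreenbergLNM1716, §2 pp. 69–72]
[cite: Kobayashi2003, Def. 1.1] -/
theorem pushH1_mem_selmerInfty_of_unramified_conditions (hκ : κ.IsCyclotomic)
    (c : subgroupH1 κ.kerSubgroup ↥((↥(W.geomPrimaryTorsion 2))[(2 : ℤ)]))
    (ha : c ∈ unramifiedOutside κ.kerSubgroup ↥((↥(W.geomPrimaryTorsion 2))[(2 : ℤ)]) 2
      (∅ : Set (HeightOneSpectrum (𝓞 ℚ))))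
    (hb : ∀ (w : InfinitePlace ℚ) (σ : Field.absoluteGaloisGroup ℚ),
      Literature.NumberTheory.EllipticCurves.conjH1 κ.kerSubgroup ↥((↥(W.geomPrimaryTorsion 2))[(2 : ℤ)]) σ c ∈
        GreenbergSelmer.infKer κ.kerSubgroup ↥((↥(W.geomPrimaryTorsion 2))[(2 : ℤ)]) w)
    (hc : ∀ (v : HeightOneSpectrum (𝓞 ℚ)), ((2 : ℕ) : 𝓞 ℚ) ∈ v.asIdeal → ∀ σ : Field.absoluteGaloisGroup ℚ,
      W.conjH1 2 κ.kerSubgroup σ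
          (pushH1 κ.kerSubgroup ((↥(W.geomPrimaryTorsion 2))[(2 : ℤ)]).subtype (subtype_torsionBy_smul W 2) c) ∈
        localKummerOverOfEmb W 2 κ.kerSubgroup (closureEmb (K := ℚ) (v.adicCompletion ℚ))
          (⨆ n : ℕ, signedLocalPoints κ (v.adicCompletion ℚ) W 1 n)) :
    pushH1 κ.kerSubgroup ((↥(W.geomPrimaryTorsion 2))[(2 : ℤ)]).subtype (subtype_torsionBy_smul W 2) c ∈
      W.selmerInfty κ := by
  set kW := pushH1 κ.kerSubgroup ((↥(W.geomPrimaryTorsion 2))[(2 : ℤ)]).subtype (subtype_torsionBy_smul W 2)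
    with hkW
  have hconj : ∀ σ : Field.absoluteGaloisGroup ℚ, W.conjH1 2 κ.kerSubgroup σ (kW c) =
      kW (Literature.NumberTheory.EllipticCurves.conjH1 κ.kerSubgroup ↥((↥(W.geomPrimaryTorsion 2))[(2 : ℤ)]) σ c) :=
    fun σ ↦ (pushH1_conjH1 κ.kerSubgroup ((↥(W.geomPrimaryTorsion 2))[(2 : ℤ)]).subtype
      (subtype_torsionBy_smul W 2) σ c).symm
  change kW c ∈ W.selmerGroupOver 2 κ.kerSubgroup
  rw [WeierstrassCurve.mem_selmerGroupOver_iff]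
  refine ⟨fun v σ ↦ ?_, fun w σ ↦ ?_⟩
  · by_cases hv2 : ((2 : ℕ) : 𝓞 ℚ) ∈ v.asIdeal
    · -- above `2`: the Kummer condition refines the classical one
      rw [WeierstrassCurve.localKerOver_eq_ofEmb]
      exact localKummerOverOfEmb_le_localKerOverOfEmb _ (hc v hv2 σ)
    · -- odd place: unramified ⇒ locally trivial over `ℚ_∞` (GV p. 17), any reduction type
      rw [hconj σ]
      have h1 := pushH1_mem_unramifiedKer κ.kerSubgroup ((↥(W.geomPrimaryTorsion 2))[(2 : ℤ)]).subtype
        (subtype_torsionBy_smul W 2) v ((mem_unramifiedOutside_iff _).mp ha v (Set.notMem_empty v) hv2 σ)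
      exact unramKer_le_localKerOver_of_isCyclotomic (κ := κ) (v := v) (W := W) (p := 2) hκ hv2 h1
  · -- archimedean place
    rw [hconj σ]
    exact infKer_le_localKerOver W 2 κ.kerSubgroup w
      (pushH1_mem_infKer κ.kerSubgroup ((↥(W.geomPrimaryTorsion 2))[(2 : ℤ)]).subtype
        (subtype_torsionBy_smul W 2) w (hb w σ))

end StepOne

/-! ## The registered stub `stub_sel2L0` of line `bridge` v11 -/

section Stub

/-- **stub sel2L0** (LOWER containment, CM side; GV Prop. (2.8) ⊇-half / Kim Prop. 2.10 READ AT `2`, for classes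
UNRAMIFIED AT EVERY ODD PLACE): a residual class `c ∈ H¹(ℚ_∞, A[2^∞][2])` unramified outside `{2}`, residually trivial at
`∞`, whose Kummer image satisfies the signed Kummer condition at `2` over `ℚ_∞` w.r.t. `⨆ₙ A⁺(ℚ_{n,2})`, has Kummer image
in Kobayashi's `Sel⁺(A/ℚ_∞) = ⋃ₙ res Sel⁺(A/ℚ_n)`. Proof: `k(c) ∈ Sel_{2^∞}(A/ℚ_∞)` (Step 1′); `k(c) = hₙ(y)`
(`exists_layerToInfty_eq`); the classical conditions of the `2ⁿ` conjugates `conj_{γ^i} y` at the places of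
`S = {bad places of A} ∪ {v ∣ 2}` and the signed Kummer witnesses at `v ∣ 2` descend to one layer `m ≥ n`
(`exists_forall_resOfLe_localSubgroup_eq_zero_of_mem_localTowerKer`, `exists_forall_conjH1_resOfLe_mem_localKummerOverOfEmb`);
off `S` and at `∞` they hold at every layer (Greenberg's Lemma 3.3 `localTowerKerPrimary_eq_bot_of_hasGoodReductionAt`,
archimedean splitting); so `res_{K_m/K_n} y ∈ Sel⁺(A/ℚ_m)` and `k(c) = h_m(res y)`. (Template: the potss cell's
`fineSelmerInfty_le_signedSelmerInfty`, with descended signed witnesses instead of torsion witnesses at `p`.)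
[cite: GreenbergVatsal2000, p. 3 and Prop. (2.8)] [cite: BDKim2009, Prop. 2.10] [cite: Kobayashi2003, Def. 1.1]
[cite: GreenbergLNM1716, §3 Lemmas 3.2–3.3 (pp. 86–88)] -/
theorem stub_sel2L0 :
    ∀ (W : WeierstrassCurve ℚ) [W.IsElliptic] [W.IsGloballyMinimal] (A : WeierstrassCurve ℚ) [A.IsElliptic]
      [A.IsGloballyMinimal], ¬ W.HasCM → W.analyticRank = 0 → GoodSS W 2 → W.frobeniusTrace 2 = 0 →
      A.HasCM → GoodSS A 2 → A.frobeniusTrace 2 = 0 →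
    (∃ e : WeierstrassCurve.geomTorsion W (2 : ℤ) ≃+ WeierstrassCurve.geomTorsion A (2 : ℤ),
      ∀ (σ : Field.absoluteGaloisGroup ℚ) (P : WeierstrassCurve.geomTorsion W (2 : ℤ)), e (σ • P) = σ • e P) →
    ∀ (κ : ZpExtension ℚ 2), κ.IsCyclotomic →
    ∀ c : subgroupH1 κ.kerSubgroup ↥((↥(A.geomPrimaryTorsion 2))[(2 : ℤ)]),
      c ∈ unramifiedOutside κ.kerSubgroup ↥((↥(A.geomPrimaryTorsion 2))[(2 : ℤ)]) 2
          (∅ : Set (HeightOneSpectrum (𝓞 ℚ))) →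
      (∀ (w : InfinitePlace ℚ) (σ : Field.absoluteGaloisGroup ℚ),
          Literature.NumberTheory.EllipticCurves.conjH1 κ.kerSubgroup ↥((↥(A.geomPrimaryTorsion 2))[(2 : ℤ)]) σ c ∈
            GreenbergSelmer.infKer κ.kerSubgroup ↥((↥(A.geomPrimaryTorsion 2))[(2 : ℤ)]) w) →
      (∀ (v : HeightOneSpectrum (𝓞 ℚ)), ((2 : ℕ) : 𝓞 ℚ) ∈ v.asIdeal → ∀ σ : Field.absoluteGaloisGroup ℚ,
          A.conjH1 2 κ.kerSubgroup σ
              (pushH1 κ.kerSubgroup ((↥(A.geomPrimaryTorsion 2))[(2 : ℤ)]).subtype (subtype_torsionBy_smul A 2) c) ∈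
            localKummerOverOfEmb A 2 κ.kerSubgroup (closureEmb (K := ℚ) (v.adicCompletion ℚ))
              (⨆ n : ℕ, signedLocalPoints κ (v.adicCompletion ℚ) A 1 n)) →
      pushH1 κ.kerSubgroup ((↥(A.geomPrimaryTorsion 2))[(2 : ℤ)]).subtype (subtype_torsionBy_smul A 2) c ∈
        signedSelmerInfty A κ 1 := by
  intro W _ _ A _ _ hCM hr hssW ha2W hCMA hssA ha2A he κ hκ c ha hb hc
  -- Step 1′: the classical Selmer conditions over `ℚ_∞`
  have hsel := pushH1_mem_selmerInfty_of_unramified_conditions A κ hκ c ha hb hc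
  -- `k(c) = hₙ(y)`; a topological generator `γ`
  obtain ⟨n, y, hy⟩ := exists_layerToInfty_eq A κ
    (pushH1 κ.kerSubgroup ((↥(A.geomPrimaryTorsion 2))[(2 : ℤ)]).subtype (subtype_torsionBy_smul A 2) c)
  obtain ⟨γ, hγ⟩ := κ.surjective (Multiplicative.ofAdd 1)
  have hγ' : κ.IsTopGenerator γ := hγ
  have hyA : y ∈ A.selmerInftyPreimage κ n := by
    rw [A.mem_selmerInftyPreimage_iff κ n y, hy]; exact hsel
  -- the finite set `S = {bad places of A} ∪ {v ∣ 2}`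
  have hT : ({v : HeightOneSpectrum (𝓞 ℚ) | ((2 : ℕ) : 𝓞 ℚ) ∈ v.asIdeal}).Finite :=
    BigGaloisRep.finite_setOf_natCast_mem_asIdeal (K := ℚ) two_ne_zero
  haveI : Fintype {v : HeightOneSpectrum (𝓞 ℚ) // ((2 : ℕ) : 𝓞 ℚ) ∈ v.asIdeal} := hT.fintype
  have hB : (A.badPlaces (𝓞 ℚ)).Finite := A.finite_badPlaces_holds (𝓞 ℚ)
  set S : Finset (HeightOneSpectrum (𝓞 ℚ)) := hB.toFinset ∪ hT.toFinset with hSdef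
  have hS : ∀ v ∉ S, ((2 : ℕ) : 𝓞 ℚ) ∉ v.asIdeal ∧ A.HasGoodReductionAt v := by
    intro v hv
    rw [hSdef, Finset.mem_union, not_or, Set.Finite.mem_toFinset, Set.Finite.mem_toFinset, Set.mem_setOf_eq] at hv
    refine ⟨hv.2, ?_⟩
    by_contra h
    exact hv.1 h
  -- descent of the classical local conditions at the places of `S`, for the `2ⁿ` conjugates `conj_{γ^i} y`
  have hcl := fun (vi : ↥S × Fin (2 ^ n)) ↦
    exists_forall_resOfLe_localSubgroup_eq_zero_of_mem_localTowerKer A κ (vi.1.1.adicCompletion ℚ) n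
      (A.localResOver_conjH1_mem_localTowerKer_of_mem κ hyA vi.1.1 (γ ^ (vi.2 : ℕ)))
  choose mc hmc using hcl
  -- descent of the signed Kummer witnesses at the places above `2`, for the same conjugates
  have hku := fun (vi : {v : HeightOneSpectrum (𝓞 ℚ) // ((2 : ℕ) : 𝓞 ℚ) ∈ v.asIdeal} × Fin (2 ^ n)) ↦
    exists_forall_conjH1_resOfLe_mem_localKummerOverOfEmb A κ (vi.1.1.adicCompletion ℚ)
      (fun m ↦ signedLocalPoints κ (vi.1.1.adicCompletion ℚ) A 1 m)
      (signedLocalPointsOfEmb_mono κ (closureEmb (K := ℚ) (vi.1.1.adicCompletion ℚ)) A 1) y (γ ^ (vi.2 : ℕ))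
      (by rw [hy]; exact hc vi.1.1 vi.1.2 _)
  choose mk hmk using hku
  -- one layer `m` past all of them
  set m : ℕ := max n (max (Finset.univ.sup mc) (Finset.univ.sup mk)) with hm
  have hnm : n ≤ m := le_max_left _ _
  have hmc' : ∀ vi, mc vi ≤ m := fun vi ↦
    (Finset.le_sup (Finset.mem_univ vi)).trans ((le_max_left _ _).trans (le_max_right _ _))
  have hmk' : ∀ vi, mk vi ≤ m := fun vi ↦
    (Finset.le_sup (Finset.mem_univ vi)).trans ((le_max_right _ _).trans (le_max_right _ _))
  set ym : A.subgroupH1 2 (κ.layerSubgroup m) := A.resOfLe 2 (κ.layerSubgroup_antitone hnm) y with hym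
  have hcm : A.layerToInfty κ m ym = A.layerToInfty κ n y := layerToInfty_resOfLe_layer A κ hnm y
  have hymA : ym ∈ A.selmerInftyPreimage κ m := by
    rw [A.mem_selmerInftyPreimage_iff, hcm, hy]; exact hsel
  -- `res_{K_m/K_n} y ∈ Sel⁺(A/ℚ_m)`
  have hmem : ym ∈ signedSelmerLayer A κ 1 m := by
    rw [mem_signedSelmerLayer_iff]
    constructor
    · -- the classical local conditions at layer `m`
      change ym ∈ A.selmerGroupOver 2 (κ.layerSubgroup m)
      rw [WeierstrassCurve.mem_selmerGroupOver_iff]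
      refine ⟨fun v σ ↦ ?_, fun w σ ↦ ?_⟩
      · rw [WeierstrassCurve.mem_localKerOver_iff]
        by_cases hv : v ∈ S
        · -- descended from `ℚ_∞`
          obtain ⟨i, hi, hiσ⟩ := exists_conjH1_eq_conjH1_pow_of_lt A κ hγ' n σ y
          rw [hym, conjH1_resOfLe_layer A κ hnm, hiσ, localResOver_resOfLe_layer A κ hnm]
          exact hmc (⟨v, hv⟩, ⟨i, hi⟩) m hnm (hmc' _)
        · -- good odd `v ∉ S`: `𝒦_{v,m}[2^∞] = 0` (Greenberg's Lemma 3.3)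
          have hK := A.localResOver_conjH1_mem_localTowerKer_of_mem κ hymA v σ
          obtain ⟨k, hk⟩ := A.exists_pow_smul_subgroupH1_layer_eq_zero κ m (A.conjH1 2 (κ.layerSubgroup m) σ ym)
          have hprim : A.localResOver 2 (κ.layerSubgroup m) (v.adicCompletion ℚ)
              (A.conjH1 2 (κ.layerSubgroup m) σ ym) ∈ A.localTowerKerPrimary κ (v.adicCompletion ℚ) m :=
            (A.mem_localTowerKerPrimary_iff κ _ m _).2 ⟨hK, k, by rw [← map_nsmul, hk, map_zero]⟩
          rw [Greenberg1999.localTowerKerPrimary_eq_bot_of_hasGoodReductionAt A κ (hS v hv).1 (hS v hv).2 m,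
            AddSubgroup.mem_bot] at hprim
          exact hprim
      · -- archimedean places split completely
        rw [WeierstrassCurve.mem_localKerOver_iff]
        have hK := A.localResOver_conjH1_mem_localTowerKer_of_mem_infinitePlace κ hymA w σ
        rw [A.localTowerKer_eq_bot_of_forall_mem κ w.Completion m
          (ZpExtension.resGal_infinitePlace_mem_kerSubgroup κ w), AddSubgroup.mem_bot] at hK
        exact hK
    · -- the signed Kummer conditions at `v ∣ 2`: descended witnesses
      intro v hv σ
      obtain ⟨i, hi, hiσ⟩ := exists_conjH1_eq_conjH1_pow_of_lt A κ hγ' n σ y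
      rw [hym, conjH1_resOfLe_layer A κ hnm, hiσ, ← conjH1_resOfLe_layer A κ hnm]
      exact hmk (⟨⟨v, hv⟩, ⟨i, hi⟩⟩) m hnm (hmk' _)
  -- `k(c) = h_m(res y) ∈ ⋃ₙ hₙ(Sel⁺(A/ℚ_n))`
  rw [← hy, ← hcm]
  exact map_layerToInfty_signedSelmerLayer_le A κ 1 m ⟨ym, hmem, rfl⟩

end Stub

end Summit.BirchSwinnertonDyer.BirchSwinnertonDyer.Theorems.SignedTransportAtTwo

end
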